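import Literature.MathematicalPhysics.QuantumFieldTheory.Balaban1983to89.HiggsCondCov232
import Literature.MathematicalPhysics.QuantumFieldTheory.Balaban1983to89.B1Eq214Concrete
import Literature.MathematicalPhysics.QuantumFieldTheory.Balaban1983to89.B4Block227

/-!
# `Balaban1983to89.B1Ineq233LowerZeroField` — T. Bałaban, *(Higgs)₂,₃ quantum fields in a finite volume. I. A lower bound*,
# Commun. Math. Phys. **85** (1982) 603–626 [Balaban1982Higgs1], Proposition 2.3 p. 611: the LOWER HALF of (2.33)
# `γ₀I ≦ aL^{−2}P(A) + Δ^{(k)}(Ω, A)` AT ZERO FIELD for the CONCRETE (Higgs)₂,₃ operators (`B1Eq230FluctCov.precOpA`),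
# with ONE explicit `γ₀` for all `k`, volumes and `ε`, DERIVED from the zero-field per-scale inequality (II.3.29)₀ /
# [B4] Prop. II.3.1′ for `Δ^{(k)}(Ω,0)` by the BLOCK POINCARÉ INEQUALITY on the concrete torus — companion of
# `B1Ineq233Upper` (the upper half) and the `hlow` input of `B1Ineq234Concrete` ((2.34)/(2.36))

statement-level skeleton of published theorems with citation tags; proofs where landed; nothing here is a claim about the Yang–Mills mass gap

PDFs held: `paper:balaban1982-cmp85-higgs23-i` (journal page = PDF page + 602), p. 611 [PDF 9]; `paper:balaban1982-cmp86-higgs23-ii`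
(journal page = PDF page + 554), pp. 589–590 [PDF 35–36]; `paper:balaban1983-cmp89-regularity-decay` (journal page = PDF page +
570), p. 580 [PDF 10] and pp. 593–594 [PDF 23–24] — read on the ×2 renders under `run/shared/lean/pub/pub-balaban/b2b-balaban-ref1/pages/`.

CITATION HEADER (lean-in-tree rule).  Cell `lit-balaban` (HOME `run/shared/lean/pub/lit-balaban/`), seat **r14** gen 7
(reader/typer of B1/B2, fold owner of SKELETON row **B1.Prop2.3**; unit `lit-balaban-r14-g7`).  WHAT IS REPRODUCED: row
B1.Prop2.3, member (2.33) LOWER HALF, kind «model instance at zero field on the concrete carrier / printed mechanism»: the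
decls of record `B1.Prop23Literal` / `B1.Prop23Intended` (pv07) are UNTOUCHED; the zero-field torus model instance of the
whole Proposition on b04's carrier is `B4Ineq118Torus.prop23Literal_torusFam` (pv07), the zero-field form lower bound on
b04's carrier `B4Prop31Zero.KeffR_form_ge`; here the same printed mechanism runs on the typer/p35 CONCRETE carriers
(`HiggsLattice` tori `T^{(k)}_{L^kε}` with arbitrary periods `2L^{K−k}ML′_μ`, fields `φ : T^{(k)} → ℝ^N`), every object BY NAME.

WHAT IS PRINTED.  B1 p. 611 [PDF 9]: *"Proposition 2.3. If a configuration A is regular on Ω …, then there exist positive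
constants δ₀, c₀, γ₀, γ₁, dependent on d and a, and independent of A, k, Ω and Λ, such that γ₀I ≦ aL^{−2}P(A) + Δ^{(k)}(Ω, A)
≦ γ₁I, (2.33)"*.  [Balaban1983RegularityDecay] p. 593 (5.1): *"aL^{−2}⟨f, P(A)f⟩ + ⟨f, Δ^{(k)}(Ω,A)f⟩ ≧ γ₀‖f‖₂², γ₀ > 0"*,
obtained there from Proposition II.3.1′; p. 580 (2.27): *"The operator −Δ^{η,N}_Δ is bounded from below … on a subspace of
functions on Δ orthogonal to constant functions … The operator P_k is an orthogonal projection on a subspace of constant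
functions, thus ⟨φ,(−Δ^{η,N}_Δ + a_kP_k)φ⟩ ≧ min{π², a_k}‖φ‖_{L²(Δ)}"* (the block Poincaré mechanism; the printed `π²` is the
cell's audited slip G-B4-03, the valid gap constant being `8` — `B4Block227`); II p. 590 (3.29): *"⟨φ′_k, Δ^{(k)}(B^k(Λ_k),
Ã^η)φ′_k⟩ ≧ γ₀(Σ_{⟨x,x′⟩⊂Λ_k}|U(Ã^η(⟨x,x′⟩))φ′_k(x′) − φ′_k(x)|² + Σ_{x∈Λ_k} m²(L^kε)²|φ′_k(x)|²) − O((L^kε)^{κ₀})|Λ_k|, (3.29) with a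
constant γ₀ independent of k, Λ_k"*; p. 589: *"If Ã^ε = 0, then the inequality holds … without any restrictions"*.

WHAT THIS FILE PROVES (kernel-checked, zero `sorry`, standard axioms; ONE plumbing definition `chart` (a block coordinate
chart), no `Prop`-valued definition, no named fact):
* §1 `avgQLin_zero_apply` (`Q(0)` = plain block mean), `siteInner_blockProjA_zero`:
  `⟨ψ, P(0)ψ⟩ = (L^kε)^d L^{−d} Σ_y ‖Σ_{x∈B(y)} ψ(x)‖²`.
* §2 **the block Poincaré inequality on the concrete torus** `block_poincare` (`k < K`, one real component):
  `Σ_{x∈B(y)} g(x)² − L^{−d}(Σ_{x∈B(y)} g(x))² ≤ (L²/8)·Σ_{b⊂B(y)}(g(b₊) − g(b₋))²` — b04's cube inequality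
  `B4Block227.poincare_coordCube8` (canonical paths, gap constant `8`) transported through p35's block coordinates
  `B1Eq214Concrete.blockSite` (`chart`, `chart_stepUp`: a step in the cube is the lattice shift; inside-block bonds by an
  injection).
* §3 `block_poincare_vec` (`ℝ^N`-valued, via the orthonormal coordinates `sum_sq_inner`), `sum_ite_inside_block_le` (a bond
  lies inside at most one block), **`siteInner_self_le_blockProjA_add`**: `‖ψ‖² ≤ ⟨ψ, P(0)ψ⟩ + (L²/8)(L^kε)²⟨∂ψ, ∂ψ⟩` for every
  field `ψ` on `T^{(k)}` ((1.5)-norms; `∂` = `HiggsLattice.sderiv` over all bonds).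
* §4 **`ineq233_lower_zero_of_delta`**: IF `γ₀⟨∂ψ,∂ψ⟩ ≤ ⟨ψ, Δ^{(k),L^kε}(Ω,0)ψ⟩` for all `ψ` (the (3.29)₀ / Prop. II.3.1′
  shape, bond part), THEN `(min{a, 8γ₀}/L²)(L^kε)^{−2}‖ψ‖² ≤ ⟨ψ, (a(L^{k+1}ε)^{−2}P(0) + Δ^{(k),L^kε}(Ω,0))ψ⟩` for every `ψ`
  (`a, γ₀ ≥ 0`, `k < K`) — the printed `γ₀I ≤ aL^{−2}P + Δ^{(k)}` at `A = 0` with `γ₀ ↦ min{a, 8γ₀}/L²` on the unit lattice,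
  uniform in `k`, the volume and `ε`.
HONEST SCOPE.  (i) Zero external field only (`P(0)` = block means; a covariant Poincaré inequality for `P(A)` is [B4]'s
business).  (ii) The (3.29)₀-type input is a HYPOTHESIS here; for `Ω = T_ε` it is p15's `B2Prop31ZeroFieldConcrete.ineq329_zero_deltaKA`
(in review at filing time) — the discharge `Ω = T_ε` is the planned v1.1 of this file; for `Ω ≠ T_ε` the typer's operators act on
all of `T^{(k)}` (bonds outside `Ω` dropped, mass everywhere), where a uniform bound over ALL fields is not the printed claim.
(iii) Constant `L²/8` from the gap bound `8` (not the printed `π²`, census G-B4-03).  (iv) Value = kernel certificate of the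
printed mechanism for the concrete objects; NOT summit progress.  Unit `lit-balaban-r14-g7` (literature-prover-lit-balaban-r14-g7-0);
HOME/FILED.md records the proposal.
-/

namespace Literature.MathematicalPhysics.QuantumFieldTheory.Balaban1983to89.B1Ineq233LowerZeroField

open HiggsLattice HiggsAveraging HiggsCovariance HiggsCovariancePos B1Eq27StepAdjoint B1Eq230FluctCov B1Eq230FluctCovPos
  HiggsFluctMeasure
open HiggsFluctMeasurePos (siteInner_comm siteInner_add_right siteInner_smul_right siteInner_self_pos)
open B1Eq214Concrete (blockSite val_blockSite blockOf_blockSite sum_block_eq_sum_blockSite sitesPerDir_eq_mul_succ)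
open Beta.BlockPoincare (avg sum_sq_eq_var_add)
open Beta.CoordCubePoincare (stepUp)
open B4Block227 (poincare_coordCube8)
open scoped BigOperators InnerProductSpace

noncomputable section

variable {P : HiggsLattice.Params} {N : ℕ} {k : ℕ}

/-! ## §1 The one-step `P(0)` in components: block means -/

section ZeroField

variable (C : ChargeData N)

/-- At `A = 0` the transports of (2.7) are `1`: `(Q(0)φ)(y) = L^{−d}Σ_{x∈B(y)}φ(x)`. [cite: Balaban1982Higgs1, (2.7) p.608] -/
theorem avgQLin_zero_apply (φ : ScalarField P k N) (y : HiggsLattice.Site P (k + 1)) :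
    avgQLin C (0 : HiggsLattice.VecField P 0) k φ y = (((P.L : ℝ) ^ P.d)⁻¹) • ∑ x ∈ HiggsLattice.block y, φ x := by
  rw [avgQLin_apply, avgQ_apply]
  congr 1
  refine Finset.sum_congr rfl fun x _ => ?_
  rw [show contourSum (0 : HiggsLattice.VecField P 0) (toFinest y) (toFinest x) = 0 by simp [contourSum, segSum],
    ChargeData.U_zero]
  rfl

/-- **`⟨ψ, P(0)ψ⟩ = (L^kε)^d·L^{−d}·Σ_y ‖Σ_{x∈B(y)} ψ(x)‖²`** (`k < K`): the form of the one-step block projection at zero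
field (`⟨ψ,P(0)ψ⟩ = ‖Q(0)ψ‖²`, `B1Eq230FluctCovPos.siteInner_blockProjA_eq`). [cite: Balaban1982Higgs1, (2.30) p.611] -/
theorem siteInner_blockProjA_zero (ψ : ScalarField P k N) :
    siteInner ψ (blockProjA C (0 : HiggsLattice.VecField P 0) k ψ)
      = P.mesh k ^ P.d * (((P.L : ℝ) ^ P.d)⁻¹ * ∑ y : HiggsLattice.Site P (k + 1), ‖∑ x ∈ HiggsLattice.block y, ψ x‖ ^ 2) := by
  rw [siteInner_blockProjA_eq, siteInner]
  have hL : (0 : ℝ) < (P.L : ℝ) ^ P.d := pow_pos (by exact_mod_cast P.hL) _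
  have hmesh : P.mesh (k + 1) ^ P.d = P.mesh k ^ P.d * (P.L : ℝ) ^ P.d := by
    rw [← mesh_succ_pow_mul k, mul_assoc, inv_mul_cancel₀ hL.ne', mul_one]
  simp_rw [avgQLin_zero_apply, real_inner_self_eq_norm_sq, norm_smul, mul_pow, Real.norm_eq_abs,
    abs_of_pos (inv_pos.mpr hL), hmesh]
  rw [Finset.mul_sum, Finset.mul_sum]
  refine Finset.sum_congr rfl fun y _ => ?_
  field_simp

end ZeroField

/-! ## §2 The Poincaré inequality on one block of `T^{(k)}` (b04's cube inequality, constant `L²/8`) -/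

section Poincare

/-- A block coordinate chart for the cube type of `B4Block227.poincare_coordCube8` (`Fin d → Fin (n+1)`, `n + 1 = L`):
`t ↦ blockSite y t` through `Fin (L−1+1) ≃ Fin L`. [cite: Balaban1982Higgs1, (1.17) p.606] -/
def chart (y : HiggsLattice.Site P (k + 1)) (t : Fin P.d → Fin (P.L - 1 + 1)) : HiggsLattice.Site P k :=
  blockSite y fun μ => finCongr (Nat.sub_add_cancel P.hL) (t μ)

/-- Label of a chart point: `L·y_μ + t_μ`. [cite: Balaban1982Higgs1, (1.17) p.606] -/
theorem val_chart (hk : k < P.K) (y : HiggsLattice.Site P (k + 1)) (t : Fin P.d → Fin (P.L - 1 + 1)) (μ : Fin P.d) :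
    ((chart y t) μ).val = (y μ).val * P.L + (t μ).val := by
  rw [chart, val_blockSite hk]
  simp

/-- The chart lands in the block `B(y)`. [cite: Balaban1982Higgs1, (1.17) p.606] -/
theorem chart_mem (hk : k < P.K) (y : HiggsLattice.Site P (k + 1)) (t : Fin P.d → Fin (P.L - 1 + 1)) :
    chart y t ∈ HiggsLattice.block y := by
  simp only [HiggsLattice.block, Finset.mem_filter, Finset.mem_univ, true_and]
  exact blockOf_blockSite hk y _

/-- The chart is injective. [cite: Balaban1982Higgs1, (1.17) p.606] -/
theorem chart_injective (hk : k < P.K) (y : HiggsLattice.Site P (k + 1)) : Function.Injective (chart y) := by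
  intro t s h
  funext μ
  have := congrArg (fun x : HiggsLattice.Site P k => (x μ).val) h
  simp only [val_chart hk] at this
  exact Fin.ext (by omega)

/-- Sums over a block are sums over the chart. [cite: Balaban1982Higgs1, (1.17) p.606] -/
theorem sum_block_eq_sum_chart (hk : k < P.K) {M : Type*} [AddCommMonoid M] (y : HiggsLattice.Site P (k + 1))
    (F : HiggsLattice.Site P k → M) :
    ∑ x ∈ HiggsLattice.block y, F x = ∑ t : Fin P.d → Fin (P.L - 1 + 1), F (chart y t) := by
  rw [sum_block_eq_sum_blockSite hk]
  exact (Fintype.sum_equiv ((Equiv.refl (Fin P.d)).arrowCongr (finCongr (Nat.sub_add_cancel P.hL)).symm)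
    _ _ (fun r => by simp [chart, Equiv.arrowCongr])).symm
    |>.symm

/-- A step `t ↦ t + e_μ` inside the cube is the lattice shift `x ↦ x + e_μ` of the chart point.
[cite: Balaban1982Higgs1, (1.17) p.606] -/
theorem chart_stepUp (hk : k < P.K) (y : HiggsLattice.Site P (k + 1)) (t : Fin P.d → Fin (P.L - 1 + 1)) (μ : Fin P.d)
    (ht : t μ ≠ Fin.last (P.L - 1)) : chart y (stepUp t μ) = (chart y t).shift μ := by
  have htv : (t μ).val < P.L - 1 := by
    have := Fin.val_lt_last ht
    simpa using this
  funext ν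
  apply ZMod.val_injective
  rw [val_chart hk]
  unfold HiggsLattice.Site.shift
  by_cases hν : ν = μ
  · subst hν
    -- no wrap-around: `L·y_ν + t_ν + 1 < sitesPerDir k ν`
    have hy : (y ν).val + 1 ≤ P.sitesPerDir (k + 1) ν := ZMod.val_lt (y ν)
    have h1 : ((y ν).val + 1) * P.L ≤ P.sitesPerDir (k + 1) ν * P.L := Nat.mul_le_mul_right _ hy
    rw [Nat.add_mul, one_mul, ← sitesPerDir_eq_mul_succ hk] at h1
    have hpos : 0 < P.L ^ (P.K - k) * P.M * P.Lp ν := Nat.mul_pos (Nat.mul_pos (pow_pos P.hL _) P.hM) (P.hLp ν)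
    have h1n : 1 < P.sitesPerDir k ν := by unfold HiggsLattice.Params.sitesPerDir; omega
    rw [Function.update_self, stepUp, Function.update_self, Fin.val_add_one_of_lt (Fin.lt_last_iff_ne_last.mpr ht),
      ZMod.val_add, ZMod.val_one_eq_one_mod, Nat.mod_eq_of_lt h1n, val_chart hk, Nat.mod_eq_of_lt (by omega)]
    omega
  · rw [Function.update_of_ne hν, stepUp, val_chart hk, Function.update_of_ne hν]

/-- **Poincaré on one block, one real component**: for `g : T^{(k)} → ℝ` and a block `B(y)` (`k < K`),
`Σ_{x∈B(y)} g(x)² − L^{−d}(Σ_{x∈B(y)} g(x))² ≤ (L²/8)·Σ_{b ⊂ B(y)} (g(b₊) − g(b₋))²` — b04's cube inequality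
`B4Block227.poincare_coordCube8` (Diaconis–Stroock paths, gap constant `8`) transported to the concrete torus.
[cite: Balaban1983RegularityDecay, (2.27) p.580] -/
theorem block_poincare (hk : k < P.K) (y : HiggsLattice.Site P (k + 1)) (g : HiggsLattice.Site P k → ℝ) :
    ∑ x ∈ HiggsLattice.block y, g x ^ 2 - ((P.L : ℝ) ^ P.d)⁻¹ * (∑ x ∈ HiggsLattice.block y, g x) ^ 2
      ≤ (P.L : ℝ) ^ 2 / 8 * ∑ b : HiggsLattice.PBond P k, if Inside (HiggsLattice.block y) b then (g b.tgt - g b.src) ^ 2 else 0 := by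
  classical
  set n := P.L - 1 with hn
  have hnL : n + 1 = P.L := Nat.sub_add_cancel P.hL
  set G : (Fin P.d → Fin (n + 1)) → ℝ := fun t => g (chart y t) with hG
  have hP := poincare_coordCube8 n P.d G
  -- the left side: variance identity
  have hcard : ((Finset.univ : Finset (Fin P.d → Fin (n + 1))).card : ℝ) = (P.L : ℝ) ^ P.d := by
    rw [Finset.card_univ, Fintype.card_fun, Fintype.card_fin, Fintype.card_fin, hnL]; push_cast; ring
  have hLd : (0 : ℝ) < (P.L : ℝ) ^ P.d := pow_pos (by exact_mod_cast P.hL) _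
  have hvar : ∑ t, (G t - avg Finset.univ G) ^ 2 = ∑ t, G t ^ 2 - ((P.L : ℝ) ^ P.d)⁻¹ * (∑ t, G t) ^ 2 := by
    have h := sum_sq_eq_var_add (Finset.univ : Finset (Fin P.d → Fin (n + 1))) G
    rw [hcard] at h
    have havg : avg Finset.univ G = (∑ t, G t) / (P.L : ℝ) ^ P.d := by rw [avg, hcard]
    rw [havg] at h ⊢
    field_simp
    field_simp at h
    linarith
  have hsum1 : ∑ t, G t ^ 2 = ∑ x ∈ HiggsLattice.block y, g x ^ 2 := by
    simp only [hG]; exact (sum_block_eq_sum_chart hk y (fun x => g x ^ 2)).symm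
  have hsum2 : ∑ t, G t = ∑ x ∈ HiggsLattice.block y, g x := by
    simp only [hG]; exact (sum_block_eq_sum_chart hk y g).symm
  rw [hvar, hsum1, hsum2] at hP
  -- the right side: inside-block bonds, by an injection (μ, t) ↦ ⟨chart t, μ⟩
  have hnn : ((n : ℝ) + 1) = (P.L : ℝ) := by exact_mod_cast hnL
  rw [hnn] at hP
  refine hP.trans (mul_le_mul_of_nonneg_left ?_ (by positivity))
  -- Σ_μ Σ_{t : t μ ≠ last} (G (stepUp t μ) − G t)² ≤ Σ_b [Inside] (g b₊ − g b₋)²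
  have hre : ∑ μ, ∑ t with t μ ≠ Fin.last n, (G (stepUp t μ) - G t) ^ 2
      = ∑ p ∈ ((Finset.univ : Finset (Fin P.d)) ×ˢ (Finset.univ : Finset (Fin P.d → Fin (n + 1)))).filter
          (fun p => p.2 p.1 ≠ Fin.last n), (G (stepUp p.2 p.1) - G p.2) ^ 2 := by
    rw [Finset.sum_filter, Finset.sum_product]
    refine Finset.sum_congr rfl fun μ _ => ?_
    rw [Finset.sum_filter]
  rw [hre]
  · have hinj : Set.InjOn (fun p : Fin P.d × (Fin P.d → Fin (n + 1)) => (⟨chart y p.2, p.1⟩ : HiggsLattice.PBond P k))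
        ↑((Finset.univ : Finset (Fin P.d)) ×ˢ (Finset.univ : Finset (Fin P.d → Fin (n + 1)))
          |>.filter fun p => p.2 p.1 ≠ Fin.last n) := by
      intro p _ q _ h
      exact Prod.ext (congrArg HiggsLattice.PBond.dir h) (chart_injective hk y (congrArg HiggsLattice.PBond.src h))
    calc ∑ p ∈ ((Finset.univ : Finset (Fin P.d)) ×ˢ (Finset.univ : Finset (Fin P.d → Fin (n + 1)))).filter
            (fun p => p.2 p.1 ≠ Fin.last n), (G (stepUp p.2 p.1) - G p.2) ^ 2
        = ∑ b ∈ (((Finset.univ : Finset (Fin P.d)) ×ˢ (Finset.univ : Finset (Fin P.d → Fin (n + 1)))).filter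
            (fun p => p.2 p.1 ≠ Fin.last n)).image
              (fun p : Fin P.d × (Fin P.d → Fin (n + 1)) => (⟨chart y p.2, p.1⟩ : HiggsLattice.PBond P k)),
            (g b.tgt - g b.src) ^ 2 := by
          rw [Finset.sum_image hinj]
          refine Finset.sum_congr rfl fun p hp => ?_
          simp only [Finset.mem_filter] at hp
          simp only [hG]
          rw [chart_stepUp hk y p.2 p.1 hp.2]
          rfl
      _ ≤ ∑ b : HiggsLattice.PBond P k, if Inside (HiggsLattice.block y) b then (g b.tgt - g b.src) ^ 2 else 0 := by
          rw [← Finset.sum_filter]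
          refine Finset.sum_le_sum_of_subset_of_nonneg ?_ (fun b _ _ => sq_nonneg _)
          intro b hb
          simp only [Finset.mem_image, Finset.mem_filter, Finset.mem_product, Finset.mem_univ, true_and] at hb
          obtain ⟨p, hp, rfl⟩ := hb
          simp only [Finset.mem_filter, Finset.mem_univ, true_and, Inside]
          refine ⟨chart_mem hk y p.2, ?_⟩
          show (chart y p.2).shift p.1 ∈ _
          rw [← chart_stepUp hk y p.2 p.1 hp]
          exact chart_mem hk y _

end Poincare

/-! ## §3 The block Poincaré inequality for `ℝ^N`-valued fields, summed over the blocks of `T^{(k)}` -/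

section Vector

/-- `Σ_i ⟨b_i, v⟩² = ‖v‖²` for the standard orthonormal basis `b` of `ℝ^N`. [cite: Balaban1982Higgs1, (1.5) p.604] -/
theorem sum_sq_inner (v : E N) : ∑ i, (⟪stdOrthonormalBasis ℝ (E N) i, v⟫_ℝ) ^ 2 = ‖v‖ ^ 2 := by
  rw [← real_inner_self_eq_norm_sq, ← (stdOrthonormalBasis ℝ (E N)).sum_inner_mul_inner v v]
  refine Finset.sum_congr rfl fun i _ => ?_
  rw [real_inner_comm v, sq]

/-- **Poincaré on one block, `ℝ^N`-valued**: `Σ_{x∈B(y)}‖ψ(x)‖² − L^{−d}‖Σ_{x∈B(y)}ψ(x)‖² ≤ (L²/8)Σ_{b⊂B(y)}‖ψ(b₊) − ψ(b₋)‖²`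
(`k < K`; componentwise from `block_poincare`). [cite: Balaban1983RegularityDecay, (2.27) p.580] -/
theorem block_poincare_vec (hk : k < P.K) (y : HiggsLattice.Site P (k + 1)) (ψ : ScalarField P k N) :
    ∑ x ∈ HiggsLattice.block y, ‖ψ x‖ ^ 2 - ((P.L : ℝ) ^ P.d)⁻¹ * ‖∑ x ∈ HiggsLattice.block y, ψ x‖ ^ 2
      ≤ (P.L : ℝ) ^ 2 / 8 *
        ∑ b : HiggsLattice.PBond P k, if Inside (HiggsLattice.block y) b then ‖ψ b.tgt - ψ b.src‖ ^ 2 else 0 := by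
  set bas := stdOrthonormalBasis ℝ (E N) with hbas
  have key := fun i => block_poincare hk y (fun x => ⟪bas i, ψ x⟫_ℝ)
  have hsum := Finset.sum_le_sum fun i (_ : i ∈ Finset.univ) => key i
  -- left side
  have hL : ∑ i, (∑ x ∈ HiggsLattice.block y, ⟪bas i, ψ x⟫_ℝ ^ 2
      - ((P.L : ℝ) ^ P.d)⁻¹ * (∑ x ∈ HiggsLattice.block y, ⟪bas i, ψ x⟫_ℝ) ^ 2)
      = ∑ x ∈ HiggsLattice.block y, ‖ψ x‖ ^ 2 - ((P.L : ℝ) ^ P.d)⁻¹ * ‖∑ x ∈ HiggsLattice.block y, ψ x‖ ^ 2 := by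
    rw [Finset.sum_sub_distrib, Finset.sum_comm, ← Finset.mul_sum]
    congr 1
    · exact Finset.sum_congr rfl fun x _ => sum_sq_inner (ψ x)
    · congr 1
      rw [← sum_sq_inner (∑ x ∈ HiggsLattice.block y, ψ x)]
      refine Finset.sum_congr rfl fun i _ => ?_
      rw [inner_sum]
  -- right side
  have hR : ∑ i, ((P.L : ℝ) ^ 2 / 8 * ∑ b : HiggsLattice.PBond P k,
      if Inside (HiggsLattice.block y) b then (⟪bas i, ψ b.tgt⟫_ℝ - ⟪bas i, ψ b.src⟫_ℝ) ^ 2 else 0)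
      = (P.L : ℝ) ^ 2 / 8 *
        ∑ b : HiggsLattice.PBond P k, if Inside (HiggsLattice.block y) b then ‖ψ b.tgt - ψ b.src‖ ^ 2 else 0 := by
    rw [← Finset.mul_sum, Finset.sum_comm]
    congr 1
    refine Finset.sum_congr rfl fun b _ => ?_
    split_ifs with h
    · rw [← sum_sq_inner (ψ b.tgt - ψ b.src)]
      refine Finset.sum_congr rfl fun i _ => ?_
      rw [inner_sub_right]
    · simp
  rw [hL, hR] at hsum
  exact hsum

/-- A bond lies inside at most one block: `Σ_y 1[b ⊂ B(y)]·G ≤ G` for `G ≥ 0`. [cite: Balaban1982Higgs1, (1.17) p.606] -/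
theorem sum_ite_inside_block_le (b : HiggsLattice.PBond P k) {G : ℝ} (hG : 0 ≤ G) :
    ∑ y : HiggsLattice.Site P (k + 1), (if Inside (HiggsLattice.block y) b then G else 0) ≤ G := by
  classical
  calc ∑ y : HiggsLattice.Site P (k + 1), (if Inside (HiggsLattice.block y) b then G else 0)
      ≤ ∑ y : HiggsLattice.Site P (k + 1), (if HiggsLattice.blockOf b.src = y then G else 0) := by
        refine Finset.sum_le_sum fun y _ => ?_
        by_cases h : Inside (HiggsLattice.block y) b
        · have hy : HiggsLattice.blockOf b.src = y := by
            have := h.1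
            simp only [HiggsLattice.block, Finset.mem_filter, Finset.mem_univ, true_and] at this
            exact this
          rw [if_pos h, if_pos hy]
        · rw [if_neg h]
          split_ifs <;> linarith
    _ = G := by rw [Finset.sum_ite_eq, if_pos (Finset.mem_univ _)]

/-- **`‖ψ‖² ≤ ⟨ψ, P(0)ψ⟩ + (L²/8)(L^kε)²·⟨∂ψ, ∂ψ⟩`** for every field `ψ` on `T^{(k)}` (`k < K`; (1.5)-norms, `∂` the lattice
derivative `HiggsLattice.sderiv` over all bonds of `T^{(k)}`): the blocks partition `T^{(k)}`, the block means are `P(0)`,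
and the in-block fluctuations are bounded by the block Poincaré inequality. [cite: Balaban1983RegularityDecay, (2.27) p.580] -/
theorem siteInner_self_le_blockProjA_add (C : ChargeData N) (hk : k < P.K) (ψ : ScalarField P k N) :
    siteInner ψ ψ ≤ siteInner ψ (blockProjA C (0 : HiggsLattice.VecField P 0) k ψ)
      + (P.L : ℝ) ^ 2 / 8 * P.mesh k ^ 2 * bondInner (sderiv ψ) (sderiv ψ) := by
  classical
  have hm : 0 < P.mesh k := P.mesh_pos k
  have hmd : 0 < P.mesh k ^ P.d := pow_pos hm _
  -- the three sums, block by block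
  have h1 : siteInner ψ ψ = P.mesh k ^ P.d * ∑ y : HiggsLattice.Site P (k + 1), ∑ x ∈ HiggsLattice.block y, ‖ψ x‖ ^ 2 := by
    rw [siteInner, ← Finset.mul_sum]
    congr 1
    simp_rw [real_inner_self_eq_norm_sq]
    exact (Finset.sum_fiberwise_of_maps_to (s := Finset.univ) (t := Finset.univ)
      (g := fun x : HiggsLattice.Site P k => HiggsLattice.blockOf x) (fun _ _ => Finset.mem_univ _) _).symm
  have h2 := siteInner_blockProjA_zero C (k := k) ψ
  have h3 : P.mesh k ^ 2 * bondInner (sderiv ψ) (sderiv ψ)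
      = P.mesh k ^ P.d * ∑ b : HiggsLattice.PBond P k, ‖ψ b.tgt - ψ b.src‖ ^ 2 := by
    rw [bondInner, Finset.mul_sum, Finset.mul_sum]
    refine Finset.sum_congr rfl fun b _ => ?_
    rw [real_inner_self_eq_norm_sq, HiggsLattice.sderiv, norm_smul, mul_pow, Real.norm_eq_abs, abs_inv,
      abs_of_pos hm]
    field_simp
  have h4 : ∑ y : HiggsLattice.Site P (k + 1), ∑ b : HiggsLattice.PBond P k,
      (if Inside (HiggsLattice.block y) b then ‖ψ b.tgt - ψ b.src‖ ^ 2 else 0)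
      ≤ ∑ b : HiggsLattice.PBond P k, ‖ψ b.tgt - ψ b.src‖ ^ 2 := by
    rw [Finset.sum_comm]
    exact Finset.sum_le_sum fun b _ => sum_ite_inside_block_le b (sq_nonneg _)
  have hblocks := Finset.sum_le_sum fun y (_ : y ∈ (Finset.univ : Finset (HiggsLattice.Site P (k + 1)))) =>
    block_poincare_vec hk y ψ
  rw [Finset.sum_sub_distrib, ← Finset.mul_sum, ← Finset.mul_sum] at hblocks
  rw [h1, h2, mul_assoc ((P.L : ℝ) ^ 2 / 8), h3]
  have hL8 : 0 ≤ (P.L : ℝ) ^ 2 / 8 := by positivity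
  nlinarith [mul_le_mul_of_nonneg_left h4 hL8, hblocks, hmd]

end Vector

/-! ## §4 (2.33) LOWER HALF at zero field from the (3.29)₀-type bound for `Δ^{(k)}(Ω,0)` -/

section Lower

variable (C : ChargeData N) (Ω : Finset (HiggsLattice.Site P 0)) (msq a : ℝ)

/-- `L^{k+1}ε = L·L^kε`. [cite: Balaban1982Higgs1, (1.19) p.607] -/
theorem mesh_succ (k : ℕ) : P.mesh (k + 1) = P.L * P.mesh k := by
  unfold HiggsLattice.Params.mesh; rw [pow_succ]; ring

/-- **(2.33) LOWER HALF AT ZERO FIELD for the concrete operators, from the (3.29)₀ shape**: if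
`γ₀⟨∂ψ, ∂ψ⟩ ≤ ⟨ψ, Δ^{(k),L^kε}(Ω,0)ψ⟩` for all fields `ψ` on `T^{(k)}` (the zero-field per-scale inequality (II.3.29) /
[B4] Proposition 3.1′, bond part), then for EVERY `ψ`
`(min{a, 8γ₀}/L²)·(L^kε)^{−2}‖ψ‖² ≤ ⟨ψ, (a(L^{k+1}ε)^{−2}P(0) + Δ^{(k),L^kε}(Ω,0))ψ⟩` (`a ≥ 0`, `γ₀ ≥ 0`, `k < K`), i.e. the
printed `γ₀I ≤ aL^{−2}P(A) + Δ^{(k)}(Ω,A)` at `A = 0` on the unit lattice with `γ₀ ↦ min{a, 8γ₀}/L²` — uniform in `k`,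
the volume and `ε`. [cite: Balaban1982Higgs1, Prop. 2.3 (2.33) p.611] -/
theorem ineq233_lower_zero_of_delta (hk : k < P.K) (ha : 0 ≤ a) {γ₀ : ℝ} (hγ : 0 ≤ γ₀)
    (hΔ : ∀ ψ : ScalarField P k N, γ₀ * bondInner (sderiv ψ) (sderiv ψ)
      ≤ siteInner ψ (deltaKA C Ω (0 : HiggsLattice.VecField P 0) msq a k ψ))
    (ψ : ScalarField P k N) :
    min a (8 * γ₀) / (P.L : ℝ) ^ 2 * ((P.mesh k)⁻¹ ^ 2) * siteInner ψ ψ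
      ≤ siteInner ψ (precOpA C Ω (0 : HiggsLattice.VecField P 0) msq a k ψ) := by
  have hL : (1 : ℝ) ≤ (P.L : ℝ) := by exact_mod_cast P.hL
  have hL0 : (0 : ℝ) < (P.L : ℝ) := by linarith
  have hm : 0 < P.mesh k := P.mesh_pos k
  set X := siteInner ψ (blockProjA C (0 : HiggsLattice.VecField P 0) k ψ) with hX
  set S := bondInner (sderiv ψ) (sderiv ψ) with hS
  have hX0 : 0 ≤ X := siteInner_blockProjA_nonneg C 0 k ψ
  have hS0 : 0 ≤ S := by
    rw [hS, bondInner]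
    exact Finset.sum_nonneg fun b _ => mul_nonneg (pow_nonneg hm.le _) real_inner_self_nonneg
  have hψ := siteInner_self_le_blockProjA_add C hk ψ
  have hprec : siteInner ψ (precOpA C Ω (0 : HiggsLattice.VecField P 0) msq a k ψ)
      = a * ((P.mesh (k + 1))⁻¹ ^ 2) * X + siteInner ψ (deltaKA C Ω (0 : HiggsLattice.VecField P 0) msq a k ψ) := by
    rw [precOpA, LinearMap.add_apply, LinearMap.smul_apply, siteInner_add_right, siteInner_smul_right]
  rw [hprec, mesh_succ]
  have hmin1 : min a (8 * γ₀) ≤ a := min_le_left _ _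
  have hmin2 : min a (8 * γ₀) ≤ 8 * γ₀ := min_le_right _ _
  have hmin0 : 0 ≤ min a (8 * γ₀) := le_min ha (by linarith)
  have hΔψ := hΔ ψ
  rw [← hS, ← hX] at *
  -- c·m⁻²‖ψ‖² ≤ c·m⁻²·X + (c L²/8)·S ≤ a(Lm)⁻²X + γ₀S
  have hinv : ((P.L : ℝ) * P.mesh k)⁻¹ ^ 2 = ((P.L : ℝ) ^ 2)⁻¹ * (P.mesh k)⁻¹ ^ 2 := by
    rw [mul_inv, mul_pow, inv_pow]
  rw [hinv]
  have hm2 : 0 < (P.mesh k)⁻¹ ^ 2 := by positivity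
  have hc0 : (0 : ℝ) ≤ min a (8 * γ₀) / (P.L : ℝ) ^ 2 * (P.mesh k)⁻¹ ^ 2 :=
    mul_nonneg (div_nonneg hmin0 (pow_nonneg hL0.le 2)) hm2.le
  have h1 : min a (8 * γ₀) / (P.L : ℝ) ^ 2 * (P.mesh k)⁻¹ ^ 2 * siteInner ψ ψ
      ≤ min a (8 * γ₀) / (P.L : ℝ) ^ 2 * (P.mesh k)⁻¹ ^ 2 * (X + (P.L : ℝ) ^ 2 / 8 * P.mesh k ^ 2 * S) :=
    mul_le_mul_of_nonneg_left hψ hc0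
  have h2 : min a (8 * γ₀) / (P.L : ℝ) ^ 2 * (P.mesh k)⁻¹ ^ 2 * (X + (P.L : ℝ) ^ 2 / 8 * P.mesh k ^ 2 * S)
      = min a (8 * γ₀) / (P.L : ℝ) ^ 2 * (P.mesh k)⁻¹ ^ 2 * X + min a (8 * γ₀) / 8 * S := by
    field_simp
  have h3 : min a (8 * γ₀) / (P.L : ℝ) ^ 2 * (P.mesh k)⁻¹ ^ 2 * X ≤ a * (((P.L : ℝ) ^ 2)⁻¹ * (P.mesh k)⁻¹ ^ 2) * X := by
    have : min a (8 * γ₀) / (P.L : ℝ) ^ 2 * (P.mesh k)⁻¹ ^ 2 ≤ a * (((P.L : ℝ) ^ 2)⁻¹ * (P.mesh k)⁻¹ ^ 2) := by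
      rw [div_eq_mul_inv, mul_assoc]
      exact mul_le_mul_of_nonneg_right hmin1 (by positivity)
    exact mul_le_mul_of_nonneg_right this hX0
  have h4 : min a (8 * γ₀) / 8 * S ≤ γ₀ * S := mul_le_mul_of_nonneg_right (by linarith) hS0
  linarith [h1, h2, h3, h4, hΔψ]

end Lower

end

end Literature.MathematicalPhysics.QuantumFieldTheory.Balaban1983to89.B1Ineq233LowerZeroField
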